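import Summits.ResolutionOfSingularities.ResolutionOfSingularities.Theorems.FrobeniusLadderFRationalResolutionVeroneseConeResolution
import Summits.ResolutionOfSingularities.ResolutionOfSingularities.Theorems.FrobeniusLadderFRationalResolutionVeroneseConePackage
import Literature.AlgebraicGeometry.Resolution.BlowupsFlatBaseChange
import Mathlib.AlgebraicGeometry.Morphisms.UnderlyingMap
import HarnessLib

/-!
# Cone programme, Veronese family: singular locus = the vertex, and the specimen sheet with dimension

Support file for crux stmt-ResolutionOfSingularities-15317 (`FrobeniusLadder.FRationalResolution`), line `redirect`,
CONE PROGRAMME — the Veronese twin of `…SegreRegularOffVertex.lean` / `…SegreSingularLocus.lean`. For the Veronese ring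
`VR[n,r] = k[χᵈ : |d| = r] ⊆ k[x₁,…,xₙ]` with vertex ideal `VM = (χᵈ : |d| = r)`:

* `veroneseCone_isRegular_affineBlowup` — `Bl_{VM} Spec VR[n,r]` is a REGULAR scheme (`1 ≤ r`): the pure-power charts
  `D₊(xᵢʳ t) ≅ 𝔸ⁿ` cover it (the regularity step of `hasResolution_veroneseCone`, p795532, extracted as a theorem);
* `veroneseCone_mem_regularLocus_of_not_mem` — the cone is regular off the vertex: a prime not containing some `χᵈ`
  (`|d| = r`) is a regular point (blow-up iso over `D(χᵈ)`, `affineBlowup.isIso_morphismRestrict`; regularity passes to the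
  image point, `mem_regularLocus_iff_of_isIso_morphismRestrict`);
* `veroneseCone_not_mem_regularLocus_of_forall_mem` (`n, r ≥ 2`) — a prime containing every `χᵈ` is a SINGULAR point
  (`stub_veronese_vertex_not_regular`, `stub_veronese_ringKrullDim`, `Spec.stalkIso`);
* `veroneseCone_mem_regularLocus_iff`, `veroneseCone_existsUnique_vertex` (`veroneseSing_mem_vertex_iff`),
  `veroneseCone_compl_regularLocus_eq_singleton` — **`Sing(V(n,r))` is exactly ONE point** (`n, r ≥ 2`);
* `veroneseCone_specimen` — for every prime `p`, field `k` of characteristic `p`, `n, r ≥ 2`: `dim VR[n,r] = n`, domain with every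
  ideal tightly closed (`veroneseCone_residualClass`), exactly one singular point, and a resolution of singularities
  (`hasResolution_veroneseCone`) — resolved ISOLATED singular members of the residual class in every dimension `n ≥ 2` and every
  characteristic, including the wild case `p ∣ r` (`V(n,r) = 𝔸ⁿ/μ_r`).
[folklore; cf. BrunsHerzog1998 Ex. 2.2.24; Kollár 2007 §2.2; StacksProject Tag 02OS] Only Mathlib and landed tree files are used.
-/

-- single-problem summit: the doubled namespace component is forced
set_option linter.dupNamespace false

noncomputable section

namespace Summit.ResolutionOfSingularities.ResolutionOfSingularities.Theorems.FRationalResolution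

open MvPolynomial AlgebraicGeometry TopologicalSpace
open Literature.AlgebraicGeometry.Resolution

section Cones

variable (k : Type) [Field k]

/-- The polynomial ring in `n` variables. -/
local notation3 "MP[" n "]" => MvPolynomial (Fin n) k

/-- The `r`-th Veronese subring of `k[x₁,…,xₙ]`: the `k`-subalgebra generated by the degree-`r` monomials. -/
local notation3 "VR[" n ", " r "]" =>
  Algebra.adjoin k ((fun d : Fin n →₀ ℕ => MvPolynomial.monomial d (1 : k)) ''
    {d : Fin n →₀ ℕ | Finsupp.degree d = (r : ℕ)})

/-- The vertex ideal of the Veronese cone: spanned by the degree-`r` monomials. -/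
local notation3 "VM[" n ", " r "]" =>
  Ideal.span {v : ↥VR[n, r] | ∃ d : Fin n →₀ ℕ, Finsupp.degree d = (r : ℕ) ∧
    (v : MvPolynomial (Fin n) k) = MvPolynomial.monomial d 1}

/-! ## The blown-up cone is regular; the cone is regular off the vertex -/

/-- **`Bl_{VM} Spec k[χᵈ : |d| = r]` is a regular scheme** (`1 ≤ r`): every point lies in a pure-power chart `D₊(xᵢʳ t)`
(`stub_affineBlowup_cover_of_pow` with `stub_veronese_pow`, `stub_finsupp_degree_split`), which is an affine `n`-space
(`stub_veronese_chart_isRegularRing`, `reesChartEquiv`, `Proj.awayι`). This is the regularity step of `hasResolution_veroneseCone`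
stated on its own. [folklore; Kollár 2007 §2.2] -/
theorem veroneseCone_isRegular_affineBlowup (n r : ℕ) (hr : 1 ≤ r) : Scheme.IsRegular (affineBlowup VM[n, r]) := by
  classical
  have hXmem : ∀ i : Fin n, ((X i : MP[n]) ^ r) ∈ VR[n, r] := fun i =>
    Algebra.subset_adjoin ⟨Finsupp.single i r, Finsupp.degree_single i r, X_pow_eq_monomial.symm⟩
  let g : Fin n → ↥VR[n, r] := fun i => ⟨(X i : MP[n]) ^ r, hXmem i⟩
  have hgval : ∀ i, ((g i : ↥VR[n, r]) : MP[n]) = X i ^ r := fun i => rfl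
  have hg : ∀ i, g i ∈ VM[n, r] := fun i =>
    Ideal.subset_span ⟨Finsupp.single i r, Finsupp.degree_single i r, X_pow_eq_monomial⟩
  have hpow : ∀ s ∈ {v : ↥VR[n, r] | ∃ d : Fin n →₀ ℕ, Finsupp.degree d = (r : ℕ) ∧ (v : MP[n]) = monomial d 1},
      ∃ i, ∃ N : ℕ, ∃ q ∈ VM[n, r] ^ N, s ^ (N + 1) = g i * q := by
    rintro s ⟨d, hd, hs⟩
    exact stub_veronese_pow k n r hr (fun s d hd => stub_finsupp_degree_split r s d hd) g hgval s d hd hs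
  refine Scheme.IsRegular.of_forall_exists_isOpenImmersion fun p => ?_
  obtain ⟨i, hi⟩ := stub_affineBlowup_cover_of_pow _ g hg hpow p
  haveI : IsRegularRing ↥(blowupAlgebra VM[n, r] (g i)) := stub_veronese_chart_isRegularRing k n r hr i (g i) rfl
  haveI : IsRegularRing (CommRingCat.of (HomogeneousLocalization.Away (reesGrading VM[n, r]) (reesT (g i) (hg i)))) :=
    IsRegularRing.of_ringEquiv (reesChartEquiv (g i) (hg i)).symm
  refine ⟨_, Proj.awayι (reesGrading VM[n, r]) (reesT (g i) (hg i)) (reesT_mem (g i) (hg i)) Nat.one_pos,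
    inferInstance, ?_, Scheme.isRegular_Spec _⟩
  rw [← Scheme.Hom.coe_opensRange, Proj.opensRange_awayι]
  exact hi

/-- **The Veronese cone is regular off its vertex** (`1 ≤ r`): if a prime `P` of `VR[n,r]` does not contain the degree-`r`
monomial `v = χᵈ`, then `P` is a regular point of `Spec VR[n,r]` — the blowing up of `VM` is an isomorphism over `D(v)`
(`affineBlowup.isIso_morphismRestrict`) with regular source (`veroneseCone_isRegular_affineBlowup`), a point over `P` exists
(isomorphisms are surjective), and regularity passes to `P` (`mem_regularLocus_iff_of_isIso_morphismRestrict`).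
[folklore; StacksProject Tag 02OS] -/
theorem veroneseCone_mem_regularLocus_of_not_mem (n r : ℕ) (hr : 1 ≤ r) (P : Spec (CommRingCat.of ↥VR[n, r]))
    (v : ↥VR[n, r]) (hv : ∃ d : Fin n →₀ ℕ, Finsupp.degree d = r ∧ (v : MP[n]) = MvPolynomial.monomial d 1)
    (hP : v ∉ P.asIdeal) : P ∈ Scheme.regularLocus (Spec (CommRingCat.of ↥VR[n, r])) := by
  have hvM : v ∈ VM[n, r] := Ideal.subset_span hv
  haveI hiso := affineBlowup.isIso_morphismRestrict (I := VM[n, r]) v hvM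
  have hreg := veroneseCone_isRegular_affineBlowup k n r hr
  have hPU : P ∈ (PrimeSpectrum.basicOpen v : (Spec (CommRingCat.of ↥VR[n, r])).Opens) := hP
  -- a point of the blowing up over `P`: the restriction over `D(v)` is an isomorphism, hence a homeomorphism
  obtain ⟨y, hy⟩ := (Scheme.Hom.homeomorph (affineBlowup.π VM[n, r] ∣_
    (PrimeSpectrum.basicOpen v : (Spec (CommRingCat.of ↥VR[n, r])).Opens))).surjective ⟨P, hPU⟩
  have hy' : (affineBlowup.π VM[n, r] ∣_
      (PrimeSpectrum.basicOpen v : (Spec (CommRingCat.of ↥VR[n, r])).Opens)) y = ⟨P, hPU⟩ := hy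
  have hx : affineBlowup.π VM[n, r] y.1 = P := by
    rw [← morphismRestrict_base_coe]
    exact congrArg Subtype.val hy'
  have hxU : affineBlowup.π VM[n, r] y.1 ∈ (PrimeSpectrum.basicOpen v : (Spec (CommRingCat.of ↥VR[n, r])).Opens) := by
    rw [hx]; exact hPU
  have h := (mem_regularLocus_iff_of_isIso_morphismRestrict (affineBlowup.π VM[n, r]) _ y.1 hxU).mp
    ((Scheme.mem_regularLocus y.1).mpr (hreg y.1))
  rwa [hx] at h

/-! ## The vertex is the unique singular point -/

/-- **A prime containing every degree-`r` monomial is a singular point of the Veronese cone** (`n, r ≥ 2`): its local ring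
`𝒪_q ≅ VR[n,r]_q` (`Spec.stalkIso`) is not regular (`stub_veronese_vertex_not_regular` with `dim VR[n,r] = n`,
`stub_veronese_ringKrullDim`). [folklore; cf. BrunsHerzog1998 Ex. 2.2.24] -/
theorem veroneseCone_not_mem_regularLocus_of_forall_mem (n r : ℕ) (hn : 2 ≤ n) (hr : 2 ≤ r)
    (q : Spec (CommRingCat.of ↥VR[n, r]))
    (hq : ∀ v : ↥VR[n, r], (∃ d : Fin n →₀ ℕ, Finsupp.degree d = r ∧ (v : MP[n]) = MvPolynomial.monomial d 1) →
      v ∈ q.asIdeal) :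
    q ∉ Scheme.regularLocus (Spec (CommRingCat.of ↥VR[n, r])) := by
  intro hreg
  haveI : IsRegularLocalRing ((Spec (CommRingCat.of ↥VR[n, r])).presheaf.stalk q) := hreg
  exact stub_veronese_vertex_not_regular k n r hn hr (stub_veronese_ringKrullDim k n r (by omega)) q hq
    (IsRegularLocalRing.of_ringEquiv (Spec.stalkIso (CommRingCat.of ↥VR[n, r]) q).commRingCatIsoToRingEquiv)

/-- **The regular locus of the Veronese cone (`n, r ≥ 2`): `P` is a regular point iff some degree-`r` monomial `χᵈ ∉ P`.**
[folklore] -/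
theorem veroneseCone_mem_regularLocus_iff (n r : ℕ) (hn : 2 ≤ n) (hr : 2 ≤ r) (P : Spec (CommRingCat.of ↥VR[n, r])) :
    P ∈ Scheme.regularLocus (Spec (CommRingCat.of ↥VR[n, r])) ↔
      ∃ v : ↥VR[n, r], (∃ d : Fin n →₀ ℕ, Finsupp.degree d = r ∧ (v : MP[n]) = MvPolynomial.monomial d 1) ∧
        v ∉ P.asIdeal := by
  constructor
  · intro hP
    by_contra h
    push Not at h
    exact veroneseCone_not_mem_regularLocus_of_forall_mem k n r hn hr P h hP
  · rintro ⟨v, hv, hvP⟩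
    exact veroneseCone_mem_regularLocus_of_not_mem k n r (by omega) P v hv hvP

/-- **Exactly one point of the Veronese cone has all `χᵈ = 0` (`|d| = r`, `1 ≤ r`): the vertex.** Existence: the kernel of the
constant coefficient; uniqueness: a prime containing all degree-`r` monomials is the set of elements with vanishing constant
coefficient (`veroneseSing_mem_vertex_iff`). [folklore] -/
theorem veroneseCone_existsUnique_vertex (n r : ℕ) (hr : 1 ≤ r) :
    ∃! q : Spec (CommRingCat.of ↥VR[n, r]), ∀ v : ↥VR[n, r],
      (∃ d : Fin n →₀ ℕ, Finsupp.degree d = r ∧ (v : MP[n]) = MvPolynomial.monomial d 1) → v ∈ q.asIdeal := by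
  classical
  let ε : ↥VR[n, r] →+* k := (constantCoeff : MP[n] →+* k).comp (VR[n, r]).val.toRingHom
  let q : Spec (CommRingCat.of ↥VR[n, r]) := ⟨RingHom.ker ε, RingHom.ker_isPrime ε⟩
  have hq : ∀ v : ↥VR[n, r], (∃ d : Fin n →₀ ℕ, Finsupp.degree d = r ∧ (v : MP[n]) = monomial d 1) → v ∈ q.asIdeal := by
    rintro v ⟨d, hd, hv⟩
    have hd0 : d ≠ 0 := by
      rintro rfl
      rw [map_zero] at hd
      omega
    change ε v = 0
    simp only [ε, RingHom.comp_apply]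
    change constantCoeff (v : MP[n]) = 0
    rw [hv, constantCoeff_monomial, if_neg hd0]
  refine ⟨q, hq, fun P hP => ?_⟩
  apply PrimeSpectrum.ext
  ext t
  rw [veroneseSing_mem_vertex_iff k n r hr P hP t,
    @veroneseSing_mem_vertex_iff k _ n r hr q hq t]

/-- **THE VERONESE CONE `V(n,r)` HAS EXACTLY ONE SINGULAR POINT** (`n, r ≥ 2`): `Sing(Spec k[χᵈ : |d| = r]) = {vertex}` — an
isolated singularity (`veroneseCone_mem_regularLocus_iff`, `veroneseCone_existsUnique_vertex`). [folklore; cf. BrunsHerzog1998 Ex. 2.2.24] -/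
theorem veroneseCone_compl_regularLocus_eq_singleton (n r : ℕ) (hn : 2 ≤ n) (hr : 2 ≤ r) :
    ∃ q : Spec (CommRingCat.of ↥VR[n, r]), (Scheme.regularLocus (Spec (CommRingCat.of ↥VR[n, r])))ᶜ = {q} := by
  obtain ⟨q, hq, huq⟩ := veroneseCone_existsUnique_vertex k n r (by omega)
  refine ⟨q, ?_⟩
  ext P
  simp only [Set.mem_compl_iff, veroneseCone_mem_regularLocus_iff k n r hn hr P, Set.mem_singleton_iff, not_exists,
    not_and, not_not]
  exact ⟨fun hP => huq P (fun v hv => hP v hv), fun hP => hP ▸ hq⟩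

/-! ## The specimen sheet -/

/-- **THE VERONESE CONES — SPECIMEN SHEET.** For every prime `p`, every field `k` of characteristic `p` and all `n, r ≥ 2`, the
Veronese cone `V(n,r) = Spec k[χᵈ : |d| = r]` (`= 𝔸ⁿ/μ_r`, wild for `p ∣ r`): has dimension `n` (`stub_veronese_ringKrullDim`);
its coordinate ring is a domain with EVERY ideal tightly closed (`veroneseCone_residualClass`); it has EXACTLY ONE singular point
(`veroneseCone_compl_regularLocus_eq_singleton`); and it HAS a resolution of singularities (`hasResolution_veroneseCone`: one
blow-up of that point). Resolved isolated singular members of the residual class in every dimension `n ≥ 2`, every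
characteristic. [folklore] -/
theorem veroneseCone_specimen (p : ℕ) [Fact p.Prime] [CharP k p] (n r : ℕ) (hn : 2 ≤ n) (hr : 2 ≤ r) :
    ringKrullDim ↥VR[n, r] = n ∧
    (IsDomain ↥VR[n, r] ∧ ∀ I : Ideal ↥VR[n, r], ∀ y c : ↥VR[n, r], c ≠ 0 →
      (∀ e : ℕ, c * y ^ p ^ e ∈ Ideal.span ((fun z : ↥VR[n, r] => z ^ p ^ e) '' (I : Set ↥VR[n, r]))) → y ∈ I) ∧
    (∃ q : Spec (CommRingCat.of ↥VR[n, r]), (Scheme.regularLocus (Spec (CommRingCat.of ↥VR[n, r])))ᶜ = {q}) ∧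
    Scheme.HasResolution (Spec (CommRingCat.of ↥VR[n, r])) :=
  ⟨stub_veronese_ringKrullDim k n r (by omega), veroneseCone_residualClass k p n r (by omega),
    veroneseCone_compl_regularLocus_eq_singleton k n r hn hr, hasResolution_veroneseCone k n r (by omega) ⟨0, by omega⟩⟩

end Cones

end Summit.ResolutionOfSingularities.ResolutionOfSingularities.Theorems.FRationalResolution

end
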